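import Summits.AtomisticToContinuum.Crystallization.Theorems.ExcessDecayLiouvilleHcpLiouvilleAnchoredBlowdown
import Summits.AtomisticToContinuum.Crystallization.Theorems.ExcessDecayLiouvilleHcpLiouvilleSymmetricShiftConformal

/-!
# `ExcessDecayLiouville.HcpLiouville` (stmt-AtomisticToContinuum-9332): composition B of line `Sketch` on the SECANT input

Line `Sketch`, skeleton v5.4 (lead c2, cycle 2).  Probe kit j025233 (`tangent0`) found the TANGENT box certificate of
v5–v5.3 (`stub_anchoredBox`: tangent box coercivity at vertex radius `1/40` about equilibrium data) numerically FALSE at the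
uniaxial `Adm` corner `diag(0.945, 0.945, 0.995)` (`λ_min = −0.036`, homogeneous pattern of sublattice-opposite
c-displacements of size `1/40`, long-wave Bloch mode), while the ray-SECANT forms from equilibrium data stay positive in
floats.  Composition B therefore takes the weaker bilinear input `SecantCoercive 0 κ₁` (ray-secant coercivity from
EQUILIBRIUM data, anchor shift `0`, displacements `≤ 1/40`), which the landed `stub_anchoredBlowdown` (p151370) consumes
directly.  Two registered sub-goals:

* `hcpLiouville_uniaxial_exact_of_secant0` — the crux for uniaxial cells with the EXACT geometric inner shift, modulo
  `SecantCoercive 0 κ₁` only (the datum is an equilibrium two-lattice by `hcpLiouville_symmetricShift_uniaxial`, p153218);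
* `hcpLiouville_of_secant0_of_anchoring` — `SecantCoercive 0` and EQUILIBRIUM ANCHORING (the open core) give the crux.

All `[folklore]`; `--supports` helpers for item stmt-AtomisticToContinuum-9332, conditional by design.
-/

noncomputable section

namespace Summit.AtomisticToContinuum.Crystallization.Theorems.ExcessDecayLiouville

open scoped BigOperators Topology Classical InnerProductSpace
open Literature.MathematicalPhysics.StatisticalMechanics
open Summit.AtomisticToContinuum.Crystallization.Theses.ExcessDecayLiouville
open Summit.AtomisticToContinuum.Crystallization.Theorems.PhononStabilityNegative

local notation "E3" => EuclideanSpace ℝ (Fin 3)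

/-- **The crux for uniaxial exactly-shifted data, modulo ray-secant coercivity from equilibrium data** (registered sub-goal
of crux stmt-AtomisticToContinuum-9332, line `Sketch` v5.4): under harmonic stability and `SecantCoercive 0 κ₁` (`κ₁ > 0`),
for a uniaxial admissible cell `A = Q ∘ (x ↦ s x + r x₂ e₃)` and a datum with `t 1 − t 0 = A (w₀ + √(2/3) e₃)` exactly,
every `δ`-separated Lennard-Jones equilibrium globally two-way `1/40`-matched with the datum is an admissible affine
two-lattice: the datum is itself an equilibrium two-lattice (`hcpLiouville_symmetricShift_uniaxial`), so the anchored
blow-down `stub_anchoredBlowdown` applies. [folklore] -/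
theorem hcpLiouville_uniaxial_exact_of_secant0 :
    PhononStability → ∀ κ₁ : ℝ, 0 < κ₁ → SecantCoercive 0 κ₁ →
      ∀ δ : ℝ, 0 < δ → ∀ X : Set E3, Sep₀ X δ → Equil₀ X →
        ∀ (t : Fin 2 → E3) (A : E3 →L[ℝ] E3) (s r : ℝ) (Q : E3 ≃ₗᵢ[ℝ] E3), Adm₀ A →
          (∀ x : E3, A x = Q (s • x + (r * x 2) • layerNormal 1)) →
          t 1 - t 0 = A (barlowOffset 1 + layerNormal (Real.sqrt (2 / 3))) →
          (∀ (c : E3) (r : ℝ), Near₀ X c r t A (1 / 40)) →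
            ∃ (t' : Fin 2 → E3) (A' : E3 →L[ℝ] E3), Adm₀ A' ∧ X = Sites₀ t' A' := by
  intro hPS κ₁ hκ₁ hSC δ hδ X hSep hEq t A s r Q hA hAQ ht hN
  have hI : Inner₀ t A := by
    unfold Inner₀; rw [ht, sub_self, norm_zero]; norm_num
  have hE : Equil₀ (Sites₀ t A) := by
    rw [equil₀_sites_iff_hasSum hA hI, ht]
    exact hcpLiouville_symmetricShift_uniaxial A s r Q hA hAQ
  exact stub_anchoredBlowdown hPS κ₁ hκ₁ hSC δ hδ X hSep hEq t A hA hI hE hN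

/-- **Composition B of line `Sketch` on the secant input** (registered sub-goal of crux stmt-AtomisticToContinuum-9332):
ray-secant coercivity from equilibrium data (`∃ κ₁ > 0, SecantCoercive 0 κ₁`) and EQUILIBRIUM ANCHORING (under the crux's
hypotheses `X` is globally two-way `1/40`-matched with some admissible hcp-like datum whose site set is in force balance)
imply the crux `HcpLiouville` — re-anchor, then `stub_anchoredBlowdown`. [folklore] -/
theorem hcpLiouville_of_secant0_of_anchoring :
    (∃ κ₁ : ℝ, 0 < κ₁ ∧ SecantCoercive 0 κ₁) →
    (PhononStability → ∀ δ : ℝ, 0 < δ → ∀ X : Set E3, Sep₀ X δ → Equil₀ X →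
      ∀ (t : Fin 2 → E3) (A : E3 →L[ℝ] E3), Adm₀ A → Inner₀ t A →
        (∀ (c : E3) (r : ℝ), Near₀ X c r t A (1 / 40)) →
          ∃ (t'' : Fin 2 → E3) (A'' : E3 →L[ℝ] E3), Adm₀ A'' ∧ Inner₀ t'' A'' ∧
            Equil₀ (Sites₀ t'' A'') ∧ ∀ (c : E3) (r : ℝ), Near₀ X c r t'' A'' (1 / 40)) →
    HcpLiouville := by
  intro hSC hEA
  obtain ⟨κ₁, hκ₁, h0⟩ := hSC
  show PhononStability → ∀ δ : ℝ, 0 < δ → ∀ X : Set E3, Sep₀ X δ → Equil₀ X →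
      ∀ (t : Fin 2 → E3) (A : E3 →L[ℝ] E3), Adm₀ A → Inner₀ t A →
        (∀ (c : E3) (r : ℝ), Near₀ X c r t A (1 / 40)) →
          ∃ (t' : Fin 2 → E3) (A' : E3 →L[ℝ] E3), Adm₀ A' ∧ X = Sites₀ t' A'
  intro hPS δ hδ X hSep hEq t A hA hI hN
  obtain ⟨t'', A'', hA'', hI'', hE'', hN''⟩ := hEA hPS δ hδ X hSep hEq t A hA hI hN
  exact stub_anchoredBlowdown hPS κ₁ hκ₁ h0 δ hδ X hSep hEq t'' A'' hA'' hI'' hE'' hN''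

end Summit.AtomisticToContinuum.Crystallization.Theorems.ExcessDecayLiouville

end
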